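import Mathlib
import Summits.Ventures.PercRepro2.Defs
import Summits.Ventures.PercRepro2.Independence
import Summits.Ventures.PercRepro2.Harris
import Summits.Ventures.PercRepro2.Graph
import Summits.Ventures.PercRepro2.Events
import Summits.Ventures.PercRepro2.Induced
import Summits.Ventures.PercRepro2.ObsIndependence
import Summits.Ventures.PercRepro2.BHK
import Summits.Ventures.PercRepro2.BHKEvents
import Summits.Ventures.PercRepro2.BHKAvoid

/-!
# Exploring the cluster of `s` under set avoidance, for an arbitrary DELETION-STABLE event
(blind cell PercRepro2, mine-c g37; `conjectures/MINE-C.md` §46.9)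

`prob_clusterIn_inter_avoid_eq_expect` (p1's file) fibres `P(C_s ∈ 𝓤, C_t ∈ 𝓥, s ↮ X)` over the
cluster `K = C_s` for a cluster property of ANOTHER root `t ∈ X`.  Here the same tower argument is
run for an arbitrary event `B` that is DELETION-STABLE along the avoided cluster — on `{s ↮ X}`,
`ω ∈ B ↔ delConfig (C_s ω) ω ∈ B` — giving `P(C_s ∈ 𝓤, B, s ↮ X) = E[1_𝓤(C_s) · delProb B (C_s) ·
1_{s↮X}]` with `delProb B W = P(delConfig W · ∈ B)` (`prob_clusterIn_inter_avoid_inter_eq_expect`).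
Two consequences: `delProb` of a LOWER set is monotone in the deleted set (`delProb_mono`), and
HARRIS inside the fibre — `delProb (B₁ ∩ B₂) W ≥ delProb B₁ W · delProb B₂ W` for lower sets
(`delProb_inter_ge_mul`).  The avoidance events `{t ↮ X}` of other roots are deletion-stable
(`deletionStable_avoidAll`, `t` in or out of the cluster), so the fibre functional of a joint
avoidance of two roots is at least the product of the two `delClusterProb`s — the Harris step of
`MINE-C.md` §46.9.
-/

namespace Summit.Ventures.PercRepro2

variable {V : Type*} {E : Type*} [Fintype E] [DecidableEq E] [Fintype V] [DecidableEq V]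
  {R : Type*} [Field R] [LinearOrder R] [IsStrictOrderedRing R]

section DelProb

variable (p : E → R) (ends : E → Sym2 V)

/-- `delProb B W = P(delConfig W · ∈ B)`: the probability of `B` after closing every edge touching
`W`. -/
noncomputable def delProb (B : Set (Config E)) (W : Set V) : R :=
  prob p {ω | delConfig ends W ω ∈ B}

variable {p ends}

omit [Fintype V] [DecidableEq V] [LinearOrder R] [IsStrictOrderedRing R] in
/-- `delProb` of a cluster property of `t` is `delClusterProb`. -/
lemma delProb_clusterIn (t : V) (𝓥 : Set (Set V)) (W : Set V) :
    delProb p ends (clusterInEvent ends t 𝓥) W = delClusterProb p ends t 𝓥 W := rfl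

omit [Fintype E] [DecidableEq E] [Fintype V] [DecidableEq V] [Field R] [LinearOrder R]
  [IsStrictOrderedRing R] in
/-- `delConfig` is monotone in the configuration. -/
lemma delConfig_mono_cfg (W : Set V) {ω ω' : Config E} (h : ω ≤ ω') :
    delConfig ends W ω ≤ delConfig ends W ω' := by
  intro e
  by_cases he : e ∈ touches ends W
  · rw [delConfig_apply_of_mem he]; exact Bool.false_le _
  · rw [delConfig_apply_of_notMem he, delConfig_apply_of_notMem he]; exact h e

omit [Fintype E] [DecidableEq E] [Fintype V] [DecidableEq V] [Field R] [LinearOrder R]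
  [IsStrictOrderedRing R] in
/-- The preimage of a lower set under `delConfig W` is a lower set. -/
lemma isLowerSet_delConfig_preimage (W : Set V) {B : Set (Config E)} (hB : IsLowerSet B) :
    IsLowerSet {ω | delConfig ends W ω ∈ B} :=
  fun _ _ h hω => hB (delConfig_mono_cfg W h) hω

omit [Fintype V] [DecidableEq V] in
/-- `delProb` is nonnegative. -/
lemma delProb_nonneg (hp : IsProbVec p) (B : Set (Config E)) (W : Set V) :
    0 ≤ delProb p ends B W :=
  prob_nonneg hp _

omit [Fintype V] [DecidableEq V] in
/-- `delProb` of a LOWER set is monotone in the deleted set: deleting more makes a decreasing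
event more likely. -/
lemma delProb_mono (hp : IsProbVec p) {B : Set (Config E)} (hB : IsLowerSet B) :
    Monotone (delProb p ends B) := by
  intro W W' h
  unfold delProb
  exact prob_mono hp fun ω hω => hB (delConfig_anti h ω) hω

omit [Fintype V] [DecidableEq V] in
/-- **Harris inside the fibre**: for lower sets `B₁, B₂`,
`delProb B₁ W · delProb B₂ W ≤ delProb (B₁ ∩ B₂) W`. -/
lemma delProb_mul_le_delProb_inter (hp : IsProbVec p) {B₁ B₂ : Set (Config E)}
    (h₁ : IsLowerSet B₁) (h₂ : IsLowerSet B₂) (W : Set V) :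
    delProb p ends B₁ W * delProb p ends B₂ W ≤ delProb p ends (B₁ ∩ B₂) W := by
  unfold delProb
  have e : {ω : Config E | delConfig ends W ω ∈ B₁ ∩ B₂} =
      {ω | delConfig ends W ω ∈ B₁} ∩ {ω | delConfig ends W ω ∈ B₂} := rfl
  rw [e]
  exact prob_mul_prob_le_prob_inter_of_isLowerSet hp (isLowerSet_delConfig_preimage W h₁)
    (isLowerSet_delConfig_preimage W h₂)

end DelProb

section Stable

variable {ends : E → Sym2 V}

omit [Fintype E] [DecidableEq E] [Fintype V] [DecidableEq V] [Field R] [LinearOrder R]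
  [IsStrictOrderedRing R] in
/-- In `delConfig W ω` a vertex of `W` is isolated. -/
lemma conn_eq_of_mem_delConfig {W : Set V} {ω : Config E} {z : V} (hz : z ∈ W) {x : V}
    (h : Conn ends (delConfig ends W ω) z x) : x = z := by
  have hS : ∀ y ∈ ({z} : Set V), ∀ x', (openGraph ends (delConfig ends W ω)).Adj y x' →
      x' ∈ ({z} : Set V) := by
    intro y hy x' hyx
    have hy' : y = z := Set.mem_singleton_iff.1 hy
    rw [hy', openGraph_adj] at hyx
    obtain ⟨_, f, hf, hends⟩ := hyx
    have hmem : f ∈ touches ends W := ⟨z, hz, x', hends⟩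
    rw [delConfig_apply_of_mem hmem] at hf
    exact absurd hf Bool.false_ne_true
  exact mem_of_conn_of_closed hS (Set.mem_singleton z) h

omit [Fintype E] [DecidableEq E] [Fintype V] [DecidableEq V] [Field R] [LinearOrder R]
  [IsStrictOrderedRing R] in
/-- An avoidance event `{t ↮ X}` of a root `t ∉ X` is DELETION-STABLE along the avoided cluster
of `s` (`s ↮ X`): if `t ∈ C_s` both sides hold (the cluster avoids `X`, and `t` is isolated after
the deletion), otherwise the cluster of `t` is untouched by the deletion. -/
lemma deletionStable_avoidAll (s t : V) {X : Finset V} (ht : t ∉ X) {ω : Config E}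
    (hω : ω ∈ avoidAll ends s X) :
    ω ∈ avoidAll ends t X ↔ delConfig ends (cluster ends ω s) ω ∈ avoidAll ends t X := by
  by_cases htK : t ∈ cluster ends ω s
  · constructor
    · intro _ x hx hc
      exact ht ((conn_eq_of_mem_delConfig htK hc) ▸ hx)
    · intro _ x hx hc
      exact hω x hx (conn_trans (mem_cluster.1 htK) hc)
  · have e := cluster_delConfig_cluster (ends := ends) (ω := ω) (s := s) htK
    constructor
    · intro h x hx hc
      have hc' : x ∈ cluster ends (delConfig ends (cluster ends ω s) ω) t := hc
      rw [e] at hc'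
      exact h x hx hc'
    · intro h x hx hc
      have hc' : x ∈ cluster ends ω t := hc
      rw [← e] at hc'
      exact h x hx hc'

end Stable

section Tower

variable (p : E → R) (ends : E → Sym2 V)

omit [DecidableEq V] [LinearOrder R] [IsStrictOrderedRing R] in
/-- **Exploring the cluster of `s` under set avoidance, for a deletion-stable event `B`**:
`P(C_s ∈ 𝓤, B, s ↮ X) = E[1_𝓤(C_s) · delProb B (C_s) · 1_{s↮X}]`. -/
theorem prob_clusterIn_inter_avoid_inter_eq_expect (s : V) {X : Finset V} (𝓤 : Set (Set V))
    (B : Set (Config E))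
    (hB : ∀ ω : Config E, ω ∈ avoidAll ends s X →
      (ω ∈ B ↔ delConfig ends (cluster ends ω s) ω ∈ B)) :
    prob p (clusterInEvent ends s 𝓤 ∩ B ∩ avoidAll ends s X) =
      expect p (fun ω => 𝓤.indicator 1 (cluster ends ω s) *
        delProb p ends B (cluster ends ω s) * (avoidAll ends s X).indicator 1 ω) := by
  classical
  let 𝓐 : Set (Set V) := {W | ∀ x ∈ X, x ∉ W}
  have hA : ∀ ω, ω ∈ avoidAll ends s X ↔ cluster ends ω s ∈ 𝓐 := fun ω => Iff.rfl
  let c : Set V → R := fun W => 𝓤.indicator 1 W * 𝓐.indicator 1 W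
  let D : Set V → Config E → R := fun W =>
    ({ω | delConfig ends W ω ∈ B} : Set (Config E)).indicator 1
  let Φ : Set V → Config E → R := fun W ω => c W * D W ω
  have hΦ : ∀ W, DependsOn (Φ W) (touches ends W)ᶜ := by
    intro W ω ω' h
    simp only [Φ, D]
    congr 1
    refine dependsOn_indicator (R := R) (fun ω ω' h => ?_) h
    show (delConfig ends W ω ∈ B) = (delConfig ends W ω' ∈ B)
    rw [delConfig_congr h]
  have hS : ∀ W : Set V, DependsOn (· ∈ {ω | cluster ends ω s = W}) (touches ends W) :=
    fun W => dependsOn_clusterEvent ends s W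
  have hdisj : ∀ W : Set V, Disjoint (touches ends W) (touches ends W)ᶜ :=
    fun W => disjoint_compl_right
  have hpt : ∀ ω, (clusterInEvent ends s 𝓤 ∩ B ∩
      avoidAll ends s X).indicator (1 : Config E → R) ω = Φ (cluster ends ω s) ω := by
    intro ω
    simp only [Φ, c, D]
    by_cases hav : ω ∈ avoidAll ends s X
    · have hmem : ω ∈ {ω' | delConfig ends (cluster ends ω s) ω' ∈ B} ↔ ω ∈ B :=
        ⟨fun h => (hB ω hav).2 h, fun h => (hB ω hav).1 h⟩
      rw [Set.indicator_of_mem (show cluster ends ω s ∈ 𝓐 from (hA ω).1 hav)]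
      by_cases h𝓤 : cluster ends ω s ∈ 𝓤
      · rw [Set.indicator_of_mem h𝓤]
        by_cases hBω : ω ∈ B
        · rw [Set.indicator_of_mem (show ω ∈ clusterInEvent ends s 𝓤 ∩ B ∩
              avoidAll ends s X from ⟨⟨h𝓤, hBω⟩, hav⟩), Set.indicator_of_mem (hmem.2 hBω)]
          simp
        · rw [Set.indicator_of_notMem (show ω ∉ clusterInEvent ends s 𝓤 ∩ B ∩
              avoidAll ends s X from fun h => hBω h.1.2),
            Set.indicator_of_notMem (fun h => hBω (hmem.1 h))]
          simp
      · rw [Set.indicator_of_notMem (show ω ∉ clusterInEvent ends s 𝓤 ∩ B ∩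
            avoidAll ends s X from fun h => h𝓤 h.1.1), Set.indicator_of_notMem h𝓤]
        simp
    · rw [Set.indicator_of_notMem (show ω ∉ clusterInEvent ends s 𝓤 ∩ B ∩
          avoidAll ends s X from fun h => hav h.2),
        Set.indicator_of_notMem (show cluster ends ω s ∉ 𝓐 from fun h => hav ((hA ω).2 h))]
      simp
  have hΦexp : ∀ W, expect p (Φ W) = c W * delProb p ends B W := by
    intro W
    simp only [Φ, D]
    rw [expect_const_mul, ← prob_eq_expect_indicator]
    rfl
  rw [prob_eq_expect_indicator]
  have e1 : (clusterInEvent ends s 𝓤 ∩ B ∩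
      avoidAll ends s X).indicator (1 : Config E → R) = fun ω => Φ (cluster ends ω s) ω :=
    funext hpt
  rw [e1, expect_tower p hdisj (S := fun ω => cluster ends ω s) hS hΦ]
  simp only [hΦexp]
  unfold expect
  refine Finset.sum_congr rfl fun ω _ => ?_
  simp only [c]
  by_cases hav : ω ∈ avoidAll ends s X
  · rw [Set.indicator_of_mem (show cluster ends ω s ∈ 𝓐 from (hA ω).1 hav),
      Set.indicator_of_mem hav]
    simp
  · rw [Set.indicator_of_notMem (show cluster ends ω s ∉ 𝓐 from fun h => hav ((hA ω).2 h)),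
      Set.indicator_of_notMem hav]
    simp

end Tower

end Summit.Ventures.PercRepro2
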